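import Summits.NavierStokesRegularity.NavierStokesRegularity.Theses.ScaledTopAlignment
import Summits.NavierStokesRegularity.NavierStokesRegularity.Theses.ThreadingFlux
import Summits.NavierStokesRegularity.NavierStokesRegularity.Theorems.ScaledTopAlignmentMostTimesRegularCase
import Summits.NavierStokesRegularity.NavierStokesRegularity.Theorems.ScaledTopAlignmentMostTimesRung
import Summits.NavierStokesRegularity.NavierStokesRegularity.Theorems.ScaledTopAlignmentWindowBulkRegularCase
import HarnessLib

/-!
# Route `ScaledTopAlignment`: the deciding crux W3ᵐᵗ = `AprioriMostTimesBulkAlignment`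
# (stmt-NavierStokesRegularity-19551) MEETS the hard core «no Type-I blow-up» (stmt-NavierStokesRegularity-1217
# = `ThreadingFlux.Target`) — kernel sandwich, BY NAME

Three facts about the OPEN door W3ᵐᵗ, all pure compositions of landed theorems:

* `threadingFluxTarget_of_aprioriMostTimesBulkAlignment` — **W3ᵐᵗ ⇒ Target (stmt-1217)**: a classical
  Leray–Hopf solution from a rapidly decaying datum with the Type-I rate at `T` extends classically past `T`
  (p5 g3's kit `false_of_mostTimesWindowBulkAligned_typeI` + the slab bound
  `liouvilleKillsTypeI_exists_bound_Icc`). So every proof of the door is a proof of the `@[hard_core]` item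
  stmt-NavierStokesRegularity-1217, and the route's `closes : W3ᵐᵗ → NoTypeII → Clay (A)` factors through it
  (`navierStokesRegularity_of_target_of_noTypeII`, the ThreadingFlux glue restated with this route's `NoTypeII`; the
  composite W3ᵐᵗ → NoTypeII → Clay (A) is the landed `navierStokesRegularity_of_aprioriMostTimesBulkAlignment_via_seq`).
* `aprioriMostTimesBulkAlignment_iff_target_of_noTypeII` — **given the route's own residual NoTypeII, the door
  IS the hard core**: `NoTypeII → (W3ᵐᵗ ↔ Target)` (← : NoTypeII + Target leave no first blow-up, and the
  regular case `mostTimesBulkAlignedAt_of_hasSmoothExtensionPast` gives the clause with `E = ∅`).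
* `doorFamily_iff_target_of_noTypeII` — the WHOLE banked door ladder of the route collapses onto the hard core
  given the residual: `NoTypeII → (W3 ↔ Target) ∧ (W3′ ↔ Target) ∧ (W3ʷᵇ ↔ Target) ∧ (W3ᵐᵗ ↔ Target)`
  (`AprioriScaledTopAlignment`, `AprioriScaledBulkAlignment`, `AprioriWindowBulkAlignment`,
  `AprioriMostTimesBulkAlignment`; each door ⇒ W3ᵐᵗ by the landed rungs, each has its regular case).
* `typeICase_mostTimesBulkAlignment_iff_target` — unconditionally, the TYPE-I CASE of the door (the only case any
  zoom/Liouville glue reads) is EQUIVALENT to Target: «Type-I rate ⇒ W3ᵐᵗ clause» ↔ stmt-1217.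
* `aprioriMostTimesBulkAlignment_iff_target_and_typeII` — unconditionally, **W3ᵐᵗ ↔ Target ∧ (the W3ᵐᵗ clause at
  every solution that neither extends past `T` nor has the Type-I rate)**: the door's content beyond the hard
  core is exactly its Type-II residue, on which no tree theorem and no printed estimate bears.

WHAT THIS IS NOT: not NS regularity; nothing here proves or refutes W3ᵐᵗ, Target or NoTypeII — implications
between OPEN statements, recorded so that the tribunal's «hard-core MEET 1217» is a kernel fact. [folklore]
-/

noncomputable section
-- the summit and its single sub-problem share the name (CONVENTIONS §1), as in every Theorems file
set_option linter.dupNamespace false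
open MeasureTheory Set Filter Topology
open Literature.Analysis Literature.Analysis.FluidPDE

namespace Summit.NavierStokesRegularity.NavierStokesRegularity.Theorems

/-- Slab bounds on every closed sub-strip `[0, T'] × ℝ³`, `T' < T`, of a classical Leray–Hopf solution from a
rapidly decaying datum (`liouvilleKillsTypeI_exists_bound_Icc`, extended to `T' ≤ 0` trivially). [folklore] -/
theorem slabBound_of_classical_lerayHopf {ν T : ℝ} (hν : 0 < ν) (hT : 0 < T)
    {u : ℝ → EuclideanSpace ℝ (Fin 3) → EuclideanSpace ℝ (Fin 3)} {p : ℝ → EuclideanSpace ℝ (Fin 3) → ℝ}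
    (hcl : IsClassicalNSSolutionOn (Ico 0 T) ν 0 u p) (hLH : IsLerayHopfOn T ν 0 (u 0) u)
    (hdec : HasRapidSpatialDecay (u 0)) :
    ∀ T' < T, ∃ M : ℝ, ∀ t ∈ Icc 0 T', ∀ x, ‖u t x‖ ≤ M := by
  intro T' hT'
  by_cases h : 0 < T'
  · exact liouvilleKillsTypeI_exists_bound_Icc hν hcl hLH hdec ⟨h, hT'⟩
  · obtain ⟨M, hM⟩ := liouvilleKillsTypeI_exists_bound_Icc hν hcl hLH hdec (T' := T / 2)
      ⟨by linarith, by linarith⟩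
    push Not at h
    exact ⟨M, fun s hs x => hM s ⟨hs.1, by linarith [hs.2]⟩ x⟩

/-- **The W3ᵐᵗ clause at one solution excludes a Type-I first blow-up there**: if a classical Leray–Hopf
solution from a rapidly decaying datum satisfies the most-times window-bulk clause (some `λ₀ < 1`, `R₀ > 0`,
`θ < 1`; `M`, `E` per `κ, ε, δ`) and has the Type-I rate at `T`, then it extends classically past `T`
(contrapositive of `false_of_mostTimesWindowBulkAligned_typeI`).
[cite: GigaMiura2011, Thm 1.1 with Rmk 1.4 and §2.1 (HUPS preprint #956 pp. 3–9)] -/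
theorem hasSmoothExtensionPast_of_mostTimesBulkAlignedAt_of_typeI {ν T : ℝ} (hν : 0 < ν) (hT : 0 < T)
    {u : ℝ → EuclideanSpace ℝ (Fin 3) → EuclideanSpace ℝ (Fin 3)} {p : ℝ → EuclideanSpace ℝ (Fin 3) → ℝ}
    (hcl : IsClassicalNSSolutionOn (Ico 0 T) ν 0 u p) (hLH : IsLerayHopfOn T ν 0 (u 0) u)
    (hdec : HasRapidSpatialDecay (u 0))
    (hW : ∃ lam0 : ℝ, lam0 < 1 ∧ ∃ R0 : ℝ, 0 < R0 ∧ ∃ θ : ℝ, θ < 1 ∧ ∀ κ : ℝ, 0 < κ → ∀ ε : ℝ, 0 < ε →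
      ∀ δ : ℝ, 0 < δ → ∃ M : ℝ, 0 < M ∧ ∃ E : Set ℝ,
        (∃ h0 : ℝ, 0 < h0 ∧ ∀ h : ℝ, 0 < h → h < h0 →
          volume (E ∩ Set.Ioo (T - h) T) ≤ ENNReal.ofReal (θ * h)) ∧
        ∀ t ∈ Set.Ico 0 T, t ∉ E → ∀ x : EuclideanSpace ℝ (Fin 3), M ≤ ‖curl (u t) x‖ →
          κ / (T - t) ≤ ‖curl (u t) x‖ →
          volume {y : EuclideanSpace ℝ (Fin 3) | lam0 * ‖curl (u t) x‖ ≤ ‖curl (u t) y‖ ∧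
              ‖x - y‖ ≤ R0 * Real.sqrt (ν / ‖curl (u t) x‖) ∧
              ε < Real.sqrt (1 - (inner ℝ (‖curl (u t) x‖⁻¹ • curl (u t) x)
                (‖curl (u t) y‖⁻¹ • curl (u t) y)) ^ 2)}
            ≤ ENNReal.ofReal (δ * Real.sqrt (ν / ‖curl (u t) x‖) ^ 3))
    (hI : IsTypeIBlowup u T) : HasSmoothExtensionPast ν 0 u T := by
  by_contra hext
  obtain ⟨lam0, hlam01, R0, hR0, θ, hθ, hfam⟩ := hW
  exact false_of_mostTimesWindowBulkAligned_typeI hν hT hcl hLH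
    (slabBound_of_classical_lerayHopf hν hT hcl hLH hdec) hI hext hlam01 hR0 hθ hfam

/-- **W3ᵐᵗ ⇒ the hard core «no Type-I blow-up»** (stmt-NavierStokesRegularity-19551 ⇒
stmt-NavierStokesRegularity-1217, BY NAME): the route's deciding crux implies `ThreadingFlux.Target` — every
classical Leray–Hopf solution from a rapidly decaying datum with the Type-I rate at `T` extends past `T`.
Hence any proof of W3ᵐᵗ proves the `@[hard_core]` item 1217. [folklore] -/
theorem threadingFluxTarget_of_aprioriMostTimesBulkAlignment
    (hW : Summit.NavierStokesRegularity.NavierStokesRegularity.Theses.ScaledTopAlignment.AprioriMostTimesBulkAlignment) :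
    Summit.NavierStokesRegularity.NavierStokesRegularity.Theses.ThreadingFlux.Target := by
  intro ν T hν hT u p hcl hLH hdec hI
  exact hasSmoothExtensionPast_of_mostTimesBulkAlignedAt_of_typeI hν hT hcl hLH hdec
    (hW ν T hν hT u p hcl hLH hdec) hI

/-- **The route's glue factors through the hard core**: `Target (1217) → NoTypeII (0056) → Clay (A)`
(the ThreadingFlux deciding theorem, restated with THIS route's `NoTypeII` decl; pure logic over
`TypeILiouville.Assembly_holds`: a non-extendable solution is maximal, hence Type I by NoTypeII, hence
extendable by Target). [folklore] -/
theorem navierStokesRegularity_of_target_of_noTypeII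
    (hT : Summit.NavierStokesRegularity.NavierStokesRegularity.Theses.ThreadingFlux.Target)
    (hII : Summit.NavierStokesRegularity.NavierStokesRegularity.Theses.ScaledTopAlignment.NoTypeII) :
    _root_.NavierStokesRegularity := by
  apply Summit.NavierStokesRegularity.NavierStokesRegularity.Theses.TypeILiouville.Assembly_holds
  intro ν T hν hT0 u p hcl hLH hdec
  by_contra hext
  exact hext (hT ν T hν hT0 u p hcl hLH hdec (hII ν T hν hT0 u p ⟨hcl, hext⟩ hLH hdec))

/-- **Given the route's residual NoTypeII, the door IS the hard core**: `NoTypeII → (W3ᵐᵗ ↔ Target)`.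
(→) is `threadingFluxTarget_of_aprioriMostTimesBulkAlignment`; (←): under NoTypeII and Target no solution
of the class fails to extend past `T`, and an extendable solution satisfies the clause with `E = ∅`
(`mostTimesBulkAlignedAt_of_hasSmoothExtensionPast`). [folklore] -/
theorem aprioriMostTimesBulkAlignment_iff_target_of_noTypeII
    (hII : Summit.NavierStokesRegularity.NavierStokesRegularity.Theses.ScaledTopAlignment.NoTypeII) :
    Summit.NavierStokesRegularity.NavierStokesRegularity.Theses.ScaledTopAlignment.AprioriMostTimesBulkAlignment ↔
      Summit.NavierStokesRegularity.NavierStokesRegularity.Theses.ThreadingFlux.Target := by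
  refine ⟨threadingFluxTarget_of_aprioriMostTimesBulkAlignment, fun hT => ?_⟩
  intro ν T hν hT0 u p hcl hLH hdec
  have hext : HasSmoothExtensionPast ν 0 u T := by
    by_contra hext
    exact hext (hT ν T hν hT0 u p hcl hLH hdec (hII ν T hν hT0 u p ⟨hcl, hext⟩ hLH hdec))
  exact mostTimesBulkAlignedAt_of_hasSmoothExtensionPast hν hT0 hcl hLH hdec hext

/-- **W3ᵐᵗ ↔ Target ∧ Type-II residue** (unconditional): the door holds iff (i) no solution of the class has a
Type-I first blow-up (`ThreadingFlux.Target`) and (ii) the W3ᵐᵗ clause holds at every solution of the class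
that neither extends past `T` nor has the Type-I rate at `T`. (→): (i) by
`threadingFluxTarget_of_aprioriMostTimesBulkAlignment`, (ii) by specialisation; (←): trichotomy
extends / Type-I singular (then extends by (i)) / non-Type-I singular, the first two through the regular case
`mostTimesBulkAlignedAt_of_hasSmoothExtensionPast`. [folklore] -/
theorem aprioriMostTimesBulkAlignment_iff_target_and_typeII :
    Summit.NavierStokesRegularity.NavierStokesRegularity.Theses.ScaledTopAlignment.AprioriMostTimesBulkAlignment ↔
      Summit.NavierStokesRegularity.NavierStokesRegularity.Theses.ThreadingFlux.Target ∧
      ∀ (ν T : ℝ), 0 < ν → 0 < T → ∀ (u : ℝ → EuclideanSpace ℝ (Fin 3) → EuclideanSpace ℝ (Fin 3))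
        (p : ℝ → EuclideanSpace ℝ (Fin 3) → ℝ),
        IsClassicalNSSolutionOn (Set.Ico 0 T) ν 0 u p → IsLerayHopfOn T ν 0 (u 0) u →
        HasRapidSpatialDecay (u 0) → ¬ HasSmoothExtensionPast ν 0 u T → ¬ IsTypeIBlowup u T →
        ∃ lam0 : ℝ, lam0 < 1 ∧ ∃ R0 : ℝ, 0 < R0 ∧ ∃ θ : ℝ, θ < 1 ∧ ∀ κ : ℝ, 0 < κ → ∀ ε : ℝ, 0 < ε →
          ∀ δ : ℝ, 0 < δ → ∃ M : ℝ, 0 < M ∧ ∃ E : Set ℝ,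
            (∃ h0 : ℝ, 0 < h0 ∧ ∀ h : ℝ, 0 < h → h < h0 →
              volume (E ∩ Set.Ioo (T - h) T) ≤ ENNReal.ofReal (θ * h)) ∧
            ∀ t ∈ Set.Ico 0 T, t ∉ E → ∀ x : EuclideanSpace ℝ (Fin 3), M ≤ ‖curl (u t) x‖ →
              κ / (T - t) ≤ ‖curl (u t) x‖ →
              volume {y : EuclideanSpace ℝ (Fin 3) | lam0 * ‖curl (u t) x‖ ≤ ‖curl (u t) y‖ ∧
                  ‖x - y‖ ≤ R0 * Real.sqrt (ν / ‖curl (u t) x‖) ∧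
                  ε < Real.sqrt (1 - (inner ℝ (‖curl (u t) x‖⁻¹ • curl (u t) x)
                    (‖curl (u t) y‖⁻¹ • curl (u t) y)) ^ 2)}
                ≤ ENNReal.ofReal (δ * Real.sqrt (ν / ‖curl (u t) x‖) ^ 3) := by
  constructor
  · intro hW
    exact ⟨threadingFluxTarget_of_aprioriMostTimesBulkAlignment hW,
      fun ν T hν hT u p hcl hLH hdec _ _ => hW ν T hν hT u p hcl hLH hdec⟩
  · rintro ⟨hT, hres⟩ ν T hν hT0 u p hcl hLH hdec
    by_cases hext : HasSmoothExtensionPast ν 0 u T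
    · exact mostTimesBulkAlignedAt_of_hasSmoothExtensionPast hν hT0 hcl hLH hdec hext
    · by_cases hI : IsTypeIBlowup u T
      · exact absurd (hT ν T hν hT0 u p hcl hLH hdec hI) hext
      · exact hres ν T hν hT0 u p hcl hLH hdec hext hI

/-! ### The banked door ladder W3 ⇒ W3′ ⇒ W3ʷᵇ ⇒ W3ᵐᵗ collapses onto the hard core modulo NoTypeII -/

/-- Every door of the family lies ABOVE the hard core: W3 ⇒ Target, W3′ ⇒ Target, W3ʷᵇ ⇒ Target (through the landed
rungs `… ⇒ W3ᵐᵗ` of `ScaledTopAlignmentMostTimesRung` and `threadingFluxTarget_of_aprioriMostTimesBulkAlignment`).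
[folklore] -/
theorem threadingFluxTarget_of_doors :
    (Summit.NavierStokesRegularity.NavierStokesRegularity.Theses.ScaledTopAlignment.AprioriScaledTopAlignment →
      Summit.NavierStokesRegularity.NavierStokesRegularity.Theses.ThreadingFlux.Target) ∧
    (Summit.NavierStokesRegularity.NavierStokesRegularity.Theses.ScaledTopAlignment.AprioriScaledBulkAlignment →
      Summit.NavierStokesRegularity.NavierStokesRegularity.Theses.ThreadingFlux.Target) ∧
    (Summit.NavierStokesRegularity.NavierStokesRegularity.Theses.ScaledTopAlignment.AprioriWindowBulkAlignment →
      Summit.NavierStokesRegularity.NavierStokesRegularity.Theses.ThreadingFlux.Target) :=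
  ⟨fun h => threadingFluxTarget_of_aprioriMostTimesBulkAlignment
      (aprioriMostTimesBulkAlignment_of_aprioriScaledTopAlignment h),
    fun h => threadingFluxTarget_of_aprioriMostTimesBulkAlignment
      (aprioriMostTimesBulkAlignment_of_aprioriScaledBulkAlignment h),
    fun h => threadingFluxTarget_of_aprioriMostTimesBulkAlignment
      (aprioriMostTimesBulkAlignment_of_aprioriWindowBulkAlignment h)⟩

/-- **Door-family collapse.** Given the route's residual NoTypeII, the four banked/deciding doors of the route —
W3 = `AprioriScaledTopAlignment` (19901), W3′ = `AprioriScaledBulkAlignment` (19438), W3ʷᵇ = `AprioriWindowBulkAlignment`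
(19447), W3ᵐᵗ = `AprioriMostTimesBulkAlignment` (19551) — are each EQUIVALENT to the hard core `ThreadingFlux.Target`
(stmt-1217), hence to one another: (→) by `threadingFluxTarget_of_doors`; (←) NoTypeII + Target leave no first blow-up in
the class, and the regular cases (`scaledTopAlignmentAt_of_hasSmoothExtensionPast`, `scaledBulkAligned_of_scaledTopAligned`,
`windowBulkAlignedAt_of_hasSmoothExtensionPast`, `mostTimesBulkAlignedAt_of_hasSmoothExtensionPast`) give each clause.
So no weakening INSIDE this family can drop below the hard core. [folklore] -/
theorem doorFamily_iff_target_of_noTypeII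
    (hII : Summit.NavierStokesRegularity.NavierStokesRegularity.Theses.ScaledTopAlignment.NoTypeII) :
    (Summit.NavierStokesRegularity.NavierStokesRegularity.Theses.ScaledTopAlignment.AprioriScaledTopAlignment ↔
      Summit.NavierStokesRegularity.NavierStokesRegularity.Theses.ThreadingFlux.Target) ∧
    (Summit.NavierStokesRegularity.NavierStokesRegularity.Theses.ScaledTopAlignment.AprioriScaledBulkAlignment ↔
      Summit.NavierStokesRegularity.NavierStokesRegularity.Theses.ThreadingFlux.Target) ∧
    (Summit.NavierStokesRegularity.NavierStokesRegularity.Theses.ScaledTopAlignment.AprioriWindowBulkAlignment ↔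
      Summit.NavierStokesRegularity.NavierStokesRegularity.Theses.ThreadingFlux.Target) ∧
    (Summit.NavierStokesRegularity.NavierStokesRegularity.Theses.ScaledTopAlignment.AprioriMostTimesBulkAlignment ↔
      Summit.NavierStokesRegularity.NavierStokesRegularity.Theses.ThreadingFlux.Target) := by
  obtain ⟨h1, h2, h3⟩ := threadingFluxTarget_of_doors
  -- under NoTypeII + Target every solution of the class extends past `T`
  have hext : Summit.NavierStokesRegularity.NavierStokesRegularity.Theses.ThreadingFlux.Target →
      ∀ (ν T : ℝ), 0 < ν → 0 < T → ∀ (u : ℝ → EuclideanSpace ℝ (Fin 3) → EuclideanSpace ℝ (Fin 3))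
        (p : ℝ → EuclideanSpace ℝ (Fin 3) → ℝ), IsClassicalNSSolutionOn (Set.Ico 0 T) ν 0 u p →
        IsLerayHopfOn T ν 0 (u 0) u → HasRapidSpatialDecay (u 0) → HasSmoothExtensionPast ν 0 u T := by
    intro hT ν T hν hT0 u p hcl hLH hdec
    by_contra hne
    exact hne (hT ν T hν hT0 u p hcl hLH hdec (hII ν T hν hT0 u p ⟨hcl, hne⟩ hLH hdec))
  refine ⟨⟨h1, fun hT => ?_⟩, ⟨h2, fun hT => ?_⟩, ⟨h3, fun hT => ?_⟩,
    aprioriMostTimesBulkAlignment_iff_target_of_noTypeII hII⟩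
  · intro ν T hν hT0 u p hcl hLH hdec lam hlam _hlam1 R hR ε hε
    exact scaledTopAlignmentAt_of_hasSmoothExtensionPast hν hT0 hcl hLH hdec
      (hext hT ν T hν hT0 u p hcl hLH hdec) hlam hR hε
  · intro ν T hν hT0 u p hcl hLH hdec
    exact scaledBulkAligned_of_scaledTopAligned (ν := ν) (T := T) (ω := fun t => curl (u t))
      fun _lam hlam _hlam1 _R hR _ε hε =>
        scaledTopAlignmentAt_of_hasSmoothExtensionPast hν hT0 hcl hLH hdec
          (hext hT ν T hν hT0 u p hcl hLH hdec) hlam hR hε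
  · intro ν T hν hT0 u p hcl hLH hdec
    exact windowBulkAlignedAt_of_hasSmoothExtensionPast hν hT0 hcl hLH hdec
      (hext hT ν T hν hT0 u p hcl hLH hdec)

/-! ### The Type-I-conditional door is the hard core, unconditionally -/

/-- **The Type-I case of the door IS the hard core (no residual needed).** The statement «at every classical
Leray–Hopf solution from a rapidly decaying datum with the Type-I rate at `T`, the W3ᵐᵗ clause holds» — which is
all of W3ᵐᵗ that any zoom/Liouville glue of this route ever reads — is EQUIVALENT to `ThreadingFlux.Target`
(stmt-1217): (→) by `hasSmoothExtensionPast_of_mostTimesBulkAlignedAt_of_typeI`; (←) Target makes such a solution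
extend past `T`, and the regular case `mostTimesBulkAlignedAt_of_hasSmoothExtensionPast` gives the clause. [folklore] -/
theorem typeICase_mostTimesBulkAlignment_iff_target :
    (∀ (ν T : ℝ), 0 < ν → 0 < T → ∀ (u : ℝ → EuclideanSpace ℝ (Fin 3) → EuclideanSpace ℝ (Fin 3))
        (p : ℝ → EuclideanSpace ℝ (Fin 3) → ℝ),
        IsClassicalNSSolutionOn (Set.Ico 0 T) ν 0 u p → IsLerayHopfOn T ν 0 (u 0) u →
        HasRapidSpatialDecay (u 0) → IsTypeIBlowup u T →
        ∃ lam0 : ℝ, lam0 < 1 ∧ ∃ R0 : ℝ, 0 < R0 ∧ ∃ θ : ℝ, θ < 1 ∧ ∀ κ : ℝ, 0 < κ → ∀ ε : ℝ, 0 < ε →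
          ∀ δ : ℝ, 0 < δ → ∃ M : ℝ, 0 < M ∧ ∃ E : Set ℝ,
            (∃ h0 : ℝ, 0 < h0 ∧ ∀ h : ℝ, 0 < h → h < h0 →
              volume (E ∩ Set.Ioo (T - h) T) ≤ ENNReal.ofReal (θ * h)) ∧
            ∀ t ∈ Set.Ico 0 T, t ∉ E → ∀ x : EuclideanSpace ℝ (Fin 3), M ≤ ‖curl (u t) x‖ →
              κ / (T - t) ≤ ‖curl (u t) x‖ →
              volume {y : EuclideanSpace ℝ (Fin 3) | lam0 * ‖curl (u t) x‖ ≤ ‖curl (u t) y‖ ∧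
                  ‖x - y‖ ≤ R0 * Real.sqrt (ν / ‖curl (u t) x‖) ∧
                  ε < Real.sqrt (1 - (inner ℝ (‖curl (u t) x‖⁻¹ • curl (u t) x)
                    (‖curl (u t) y‖⁻¹ • curl (u t) y)) ^ 2)}
                ≤ ENNReal.ofReal (δ * Real.sqrt (ν / ‖curl (u t) x‖) ^ 3)) ↔
      Summit.NavierStokesRegularity.NavierStokesRegularity.Theses.ThreadingFlux.Target := by
  constructor
  · intro h ν T hν hT u p hcl hLH hdec hI
    exact hasSmoothExtensionPast_of_mostTimesBulkAlignedAt_of_typeI hν hT hcl hLH hdec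
      (h ν T hν hT u p hcl hLH hdec hI) hI
  · intro hT ν T hν hT0 u p hcl hLH hdec hI
    exact mostTimesBulkAlignedAt_of_hasSmoothExtensionPast hν hT0 hcl hLH hdec
      (hT ν T hν hT0 u p hcl hLH hdec hI)

/-! ### Door calculus: ANY per-solution door killed by Type I and true in the regular case is the hard core -/

/-- **Door calculus (for the planners' future variants, e.g. anchor / near-maximum / sequence doors).** Let `D ν T u p`
be any per-solution clause such that (i) at a classical Leray–Hopf solution from a rapidly decaying datum with the
Type-I rate at `T`, `D` forces classical extension past `T` (a zoom/Liouville kit), and (ii) `D` holds at every such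
solution that extends past `T` (regular case). Then, unconditionally, the Type-I case of the door
«Type-I rate ⇒ D» is EQUIVALENT to `ThreadingFlux.Target` (stmt-1217); and given the residual NoTypeII the full
a-priori door «D at every solution» is EQUIVALENT to Target as well. Pure logic. [folklore] -/
theorem door_iff_target_of_kill_of_regular
    {D : ℝ → ℝ → (ℝ → EuclideanSpace ℝ (Fin 3) → EuclideanSpace ℝ (Fin 3)) →
      (ℝ → EuclideanSpace ℝ (Fin 3) → ℝ) → Prop}
    (hkill : ∀ (ν T : ℝ), 0 < ν → 0 < T → ∀ (u : ℝ → EuclideanSpace ℝ (Fin 3) → EuclideanSpace ℝ (Fin 3))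
      (p : ℝ → EuclideanSpace ℝ (Fin 3) → ℝ), IsClassicalNSSolutionOn (Set.Ico 0 T) ν 0 u p →
      IsLerayHopfOn T ν 0 (u 0) u → HasRapidSpatialDecay (u 0) → D ν T u p → IsTypeIBlowup u T →
      HasSmoothExtensionPast ν 0 u T)
    (hreg : ∀ (ν T : ℝ), 0 < ν → 0 < T → ∀ (u : ℝ → EuclideanSpace ℝ (Fin 3) → EuclideanSpace ℝ (Fin 3))
      (p : ℝ → EuclideanSpace ℝ (Fin 3) → ℝ), IsClassicalNSSolutionOn (Set.Ico 0 T) ν 0 u p →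
      IsLerayHopfOn T ν 0 (u 0) u → HasRapidSpatialDecay (u 0) → HasSmoothExtensionPast ν 0 u T → D ν T u p) :
    ((∀ (ν T : ℝ), 0 < ν → 0 < T → ∀ (u : ℝ → EuclideanSpace ℝ (Fin 3) → EuclideanSpace ℝ (Fin 3))
        (p : ℝ → EuclideanSpace ℝ (Fin 3) → ℝ), IsClassicalNSSolutionOn (Set.Ico 0 T) ν 0 u p →
        IsLerayHopfOn T ν 0 (u 0) u → HasRapidSpatialDecay (u 0) → IsTypeIBlowup u T → D ν T u p) ↔
      Summit.NavierStokesRegularity.NavierStokesRegularity.Theses.ThreadingFlux.Target) ∧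
    (Summit.NavierStokesRegularity.NavierStokesRegularity.Theses.ScaledTopAlignment.NoTypeII →
      ((∀ (ν T : ℝ), 0 < ν → 0 < T → ∀ (u : ℝ → EuclideanSpace ℝ (Fin 3) → EuclideanSpace ℝ (Fin 3))
          (p : ℝ → EuclideanSpace ℝ (Fin 3) → ℝ), IsClassicalNSSolutionOn (Set.Ico 0 T) ν 0 u p →
          IsLerayHopfOn T ν 0 (u 0) u → HasRapidSpatialDecay (u 0) → D ν T u p) ↔
        Summit.NavierStokesRegularity.NavierStokesRegularity.Theses.ThreadingFlux.Target)) := by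
  refine ⟨⟨fun h ν T hν hT u p hcl hLH hdec hI => ?_, fun hT ν T hν hT0 u p hcl hLH hdec hI => ?_⟩,
    fun hII => ⟨fun h ν T hν hT u p hcl hLH hdec hI => ?_, fun hT ν T hν hT0 u p hcl hLH hdec => ?_⟩⟩
  · exact hkill ν T hν hT u p hcl hLH hdec (h ν T hν hT u p hcl hLH hdec hI) hI
  · exact hreg ν T hν hT0 u p hcl hLH hdec (hT ν T hν hT0 u p hcl hLH hdec hI)
  · exact hkill ν T hν hT u p hcl hLH hdec (h ν T hν hT u p hcl hLH hdec) hI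
  · have hext : HasSmoothExtensionPast ν 0 u T := by
      by_contra hne
      exact hne (hT ν T hν hT0 u p hcl hLH hdec (hII ν T hν hT0 u p ⟨hcl, hne⟩ hLH hdec))
    exact hreg ν T hν hT0 u p hcl hLH hdec hext

end Summit.NavierStokesRegularity.NavierStokesRegularity.Theorems

end
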